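import Mathlib.RingTheory.TensorProduct.Basic
import Mathlib.RingTheory.TensorProduct.Free
import Mathlib.RingTheory.FiniteType
import Literature.RingTheory.CompleteIntersection.CongruenceModule
import Literature.NumberTheory.EllipticCurves.NewformEigencharacter
import HarnessLib

/-!
# The Hecke algebras `𝕋_O = 𝕋_ℤ ⊗ O` of `S_k(Γ₁(N))`, eigen-augmentations, and the
# congruence ideal of a Hecke eigensystem / of a newform

This is the Hecke-algebra instance of the congruence ideal and congruence module of
`Literature.RingTheory.CompleteIntersection.CongruenceModule` (de Smit–Rubin–Schoof, Hida),
in the setting of Darmon–Diamond–Taylor, *Fermat's Last Theorem*, §1.6, §3.3 and §4.1–4.2, and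
of Diamond–Ribet (CSS 1997, §3.1 and p. 364):

* `heckeRing1 N k` (tree: `𝕋_ℤ = ℤ[T_p, ⟨d⟩ : p prime, d ∈ (ℤ/N)ˣ] ⊆ End_ℂ S_k(Γ₁(N))`,
  Darmon–Diamond–Taylor §1.6: "We define `𝕋_ℤ` to be the ring generated over `ℤ` by the Hecke
  operators `T_n` and `⟨d⟩`"; by their Lemma 4.1 (a) the `T_p` and `⟨d⟩` generate the same
  ring) is **commutative**: `instCommRingHeckeRing1` (from the tree's
  `mul_comm_of_mem_heckeRing1`).
* `FullHeckeAlgebra N k O = O ⊗[ℤ] 𝕋_ℤ` — **the Hecke algebra `𝕋_O`** ("if `A` is any ring,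
  we define `𝕋_A` to be the `A`-algebra `𝕋_ℤ ⊗ A`", op. cit. §1.6, p. 39, and §4.1, p. 107:
  "If `R` is a ring, then `𝕋_R` denotes the `R`-algebra `𝕋_ℤ ⊗ R`"), a commutative
  `O`-algebra, finite and free over `O` when `𝕋_ℤ` is over `ℤ` (tree: all weights `k ≥ 2`);
  generators `FullHeckeAlgebra.T p`, `FullHeckeAlgebra.diamond d`.
* `eigenAugmentation θ : 𝕋_O →ₐ[O] O`, `a ⊗ T ↦ a θ(T)`, for an **`O`-valued Hecke eigensystem**
  `θ : 𝕋_ℤ →+* O` (op. cit. §4.1, p. 108: an eigenform `f` gives `θ_f : 𝕋_ℤ → K̄`; Remark 3.33: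
  "to give an `O`-algebra homomorphism `𝕋_Σ → O` is equivalent to giving a newform … with
  coefficients in `O`"); for a newform `f` one takes `θ = ι ∘ θ_f` with
  `θ_f = IsNewform1.eigencharacterInt` (`Literature.NumberTheory.EllipticCurves.
  NewformEigencharacter`) and `ι : 𝓞_f → O`.
* `heckeCongruenceIdeal θ : Ideal O` — **the congruence ideal `η_θ = π(Ann_{𝕋_O}(ker π))`** of the
  eigen-augmentation `π = eigenAugmentation θ` (Darmon–Diamond–Taylor (3.3.1):
  `η_Σ = π_Σ(Ann_{𝕋_Σ}(ker π_Σ))`; Diamond–Ribet p. 364; Hida's `C₀(θ; O) = O/η`,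
  *Modular forms and Galois cohomology* §5.3.3), and `HeckeCongruenceModule θ = O ⧸ η_θ`.
  For local `O`, the maximal ideal `𝔪 = π⁻¹(𝔪_O)` of `𝕋_O`, the local Hecke algebra `𝕋_𝔪` with
  its augmentation `𝕋_𝔪 → O` (the `π : 𝕋_Σ ≅ 𝕋_𝔪 → O` of §3.3 / Prop. 4.7) and the theorem that
  `η` computed on `𝕋_𝔪` (as printed in (3.3.1)) equals `heckeCongruenceIdeal θ` are in the
  companion file `Literature.NumberTheory.Automorphic.HeckeCongruenceIdealLocal`.
* `newformCongruenceIdeal hf ι` — **the congruence ideal `η_f` of a newform `f ∈ S_k(Γ₁(N))`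
  at `ι : 𝓞_f → O`** (`O` typically the `λ`-adic completion `𝓞_{f,λ}` for a prime `λ ∣ p` of
  the coefficient field; the "congruence ideal of `f` at `λ`" measuring congruences between `f`
  and other eigenforms of level `N`, Diamond–Ribet §4.3; Hida's `η` with `C₀(λ_f; O) ≅ O/η`).

## Not here

The identification `𝕋_Σ ≅ 𝕋_𝔪` of the reduced (Galois-side) Hecke algebra with the localised full
Hecke algebra (Darmon–Diamond–Taylor Prop. 4.7), the freeness `𝕋_𝔪`-module results
(Thm. 4.5 of Diamond–Ribet / multiplicity one), Hida's formula `η_f = L^{alg}(1, Ad f)` up to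
units (Hida 1981; Hida 2000 Thm. 5.20), the anaemic variants `𝕋^{(D)}` (Lemma 4.1 (b)), the
`Γ₀(N)`-version, and any relation with the congruence number of
`Literature.NumberTheory.EllipticCurves.ModularForms.congruenceNumber` (Agashe–Ribet–Stein).

## References

* H. Darmon, F. Diamond, R. Taylor, *Fermat's Last Theorem*, Current Developments in Math.
  1995, International Press, 1–154: §1.6 (p. 39), §3.3 with (3.3.1) and Remark 3.33 (pp. 96–97),
  §4.1 (pp. 106–109), Prop. 4.7. [DarmonDiamondTaylor1995]
* F. Diamond, K. A. Ribet, *ℓ-adic modular deformations and Wiles's "Main Conjecture"*, in: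
  Modular Forms and Fermat's Last Theorem, Springer 1997, §3.1 (p. 362), p. 364, §4.3.
  [DiamondRibet1997]
* B. de Smit, K. Rubin, R. Schoof, *Criteria for complete intersections*, ibid., p. 343.
  [DeSmitRubinSchoof1997]
* H. Hida, *Modular forms and Galois cohomology*, CUP 2000, §5.3.3 (pp. 276–277). [Hida2000]
-/

noncomputable section

open scoped TensorProduct MatrixGroups ModularForm

open CongruenceSubgroup

namespace Literature.NumberTheory.Automorphic

open Literature.NumberTheory.EllipticCurves.ModularForms
open Literature.RingTheory.CompleteIntersection

/-! ### `𝕋_ℤ` is commutative; the Hecke algebras `𝕋_O` -/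

section HeckeAlgebra

variable (N : ℕ) [NeZero N] (k : ℤ)

/-- **The Hecke ring `𝕋_ℤ = ℤ[T_p, ⟨d⟩]` of `S_k(Γ₁(N))` is a commutative ring** (the tree's
`mul_comm_of_mem_heckeRing1`, Diamond–Shurman Prop. 5.2.4), recorded as a `CommRing` structure
extending the `Ring` structure of the subalgebra `heckeRing1 N k ⊆ End_ℂ S_k(Γ₁(N))`.
[cite: DiamondShurman2005, Prop. 5.2.4] -/
instance instCommRingHeckeRing1 : CommRing (heckeRing1 N k) :=
  { (inferInstance : Ring (heckeRing1 N k)) with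
    mul_comm := fun a b => Subtype.ext (mul_comm_of_mem_heckeRing1 a.2 b.2) }

variable (O : Type*) [CommRing O]

/-- **The (full) Hecke algebra `𝕋_O = 𝕋_ℤ ⊗_ℤ O` of `S_k(Γ₁(N))` over a commutative ring `O`**
(Darmon–Diamond–Taylor §1.6, p. 39: "if `A` is any ring, we define `𝕋_A` to be the `A`-algebra
`𝕋_ℤ ⊗ A`"; §4.1, p. 107), written `O ⊗[ℤ] 𝕋_ℤ` so that Mathlib's left `O`-algebra structure on
the tensor product applies. A commutative `O`-algebra; module-finite and free over `O` whenever
`𝕋_ℤ` is so over `ℤ` (op. cit. p. 107: "`𝕋_R` … is finitely generated and free as an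
`R`-module"; in the tree for all weights `k ≥ 2`). [cite: DarmonDiamondTaylor1995, §1.6 p. 39 and §4.1 p. 107] -/
def FullHeckeAlgebra : Type _ :=
  O ⊗[ℤ] heckeRing1 N k

namespace FullHeckeAlgebra

/-! `FullHeckeAlgebra N k O` is a `def` (not an `abbrev`) on purpose: typeclass search on the
bare tensor product `O ⊗[ℤ] 𝕋_ℤ` explores many `Module`/`SMul` instances of `TensorProduct`
and becomes very slow at the weights `k = n + 2` where `𝕋_ℤ` carries `Module.Finite/Free`
instances; the structure is transported once and for all below (`inferInstanceAs`). -/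

/-- `𝕋_O` is a commutative ring (the tensor product of the commutative rings `O` and `𝕋_ℤ`).
[folklore] -/
instance instCommRing : CommRing (FullHeckeAlgebra N k O) :=
  inferInstanceAs (CommRing (O ⊗[ℤ] heckeRing1 N k))

/-- `𝕋_O` is an `O`-algebra (Mathlib's left algebra structure on `O ⊗[ℤ] 𝕋_ℤ`). [folklore] -/
instance instAlgebra : Algebra O (FullHeckeAlgebra N k O) :=
  inferInstanceAs (Algebra O (O ⊗[ℤ] heckeRing1 N k))

/-- `𝕋_O` is module-finite over `O` when `𝕋_ℤ` is over `ℤ` (Darmon–Diamond–Taylor p. 107: "`𝕋_R`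
… is finitely generated and free as an `R`-module. (This holds for `R = ℤ`, hence for arbitrary
`R`.)"). [cite: DarmonDiamondTaylor1995, §4.1, p. 107] -/
instance instModuleFinite [Module.Finite ℤ (heckeRing1 N k)] :
    Module.Finite O (FullHeckeAlgebra N k O) :=
  inferInstanceAs (Module.Finite O (O ⊗[ℤ] heckeRing1 N k))

/-- `𝕋_O` is free over `O` when `𝕋_ℤ` is over `ℤ`. [cite: DarmonDiamondTaylor1995, §4.1, p. 107] -/
instance instModuleFree [Module.Free ℤ (heckeRing1 N k)] :
    Module.Free O (FullHeckeAlgebra N k O) :=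
  inferInstanceAs (Module.Free O (O ⊗[ℤ] heckeRing1 N k))

/-- `𝕋_O` is a Noetherian ring when `O` is Noetherian and `𝕋_ℤ` is module-finite over `ℤ`
(a finite algebra over a Noetherian ring). [folklore] -/
instance instIsNoetherianRing [IsNoetherianRing O] [Module.Finite ℤ (heckeRing1 N k)] :
    IsNoetherianRing (FullHeckeAlgebra N k O) :=
  Algebra.FiniteType.isNoetherianRing O _

/-- The identification of `𝕋_O` with the tensor product `O ⊗[ℤ] 𝕋_ℤ` it is defined to be
(the identity map, as an `O`-algebra isomorphism). [folklore] -/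
def equivTensor : FullHeckeAlgebra N k O ≃ₐ[O] O ⊗[ℤ] heckeRing1 N k :=
  AlgEquiv.refl

variable {N k}

/-- The elementary tensor `a ⊗ T ∈ 𝕋_O`. [folklore] -/
def tmul (a : O) (T : heckeRing1 N k) : FullHeckeAlgebra N k O :=
  a ⊗ₜ[ℤ] T

/-- The structure map `𝕋_ℤ → 𝕋_O`, `T ↦ 1 ⊗ T` (Mathlib's `includeRight`). [folklore] -/
def ofInt : heckeRing1 N k →ₐ[ℤ] FullHeckeAlgebra N k O :=
  Algebra.TensorProduct.includeRight

/-- `ofInt T = 1 ⊗ T`. [folklore] -/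
@[simp] theorem ofInt_apply (T : heckeRing1 N k) : ofInt O T = tmul O 1 T :=
  rfl

/-- `algebraMap O 𝕋_O a = a ⊗ 1`. [folklore] -/
theorem algebraMap_apply (a : O) : algebraMap O (FullHeckeAlgebra N k O) a = tmul O a 1 :=
  rfl

/-- The Hecke operator `T_p ∈ 𝕋_O` (`1 ⊗ T_p`), `p` prime (`U_p` when `p ∣ N`).
[cite: DarmonDiamondTaylor1995, §4.1, Lemma 4.1 (a)] -/
def T (p : ℕ) (hp : p.Prime) : FullHeckeAlgebra N k O :=
  haveI : NeZero p := ⟨hp.ne_zero⟩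
  ofInt O ⟨heckeT (Gamma1 N) k p, heckeT_mem_heckeRing1 p hp⟩

/-- The diamond operator `⟨d⟩ ∈ 𝕋_O` (`1 ⊗ ⟨d⟩`), `d ∈ (ℤ/Nℤ)ˣ`.
[cite: DarmonDiamondTaylor1995, §4.1, Lemma 4.1 (a)] -/
def diamond (d : (ZMod N)ˣ) : FullHeckeAlgebra N k O :=
  ofInt O ⟨diamondOp N k (d : ZMod N), diamondOp_mem_heckeRing1 d⟩

/-- The elementary tensors span `𝕋_O` over `O`; in fact `a ⊗ T = a · (1 ⊗ T)`. [folklore] -/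
theorem tmul_eq_smul_ofInt (a : O) (T : heckeRing1 N k) : tmul O a T = a • ofInt O T := by
  change a ⊗ₜ[ℤ] T = a • ((1 : O) ⊗ₜ[ℤ] T)
  rw [TensorProduct.smul_tmul', smul_eq_mul, mul_one]

/-- Induction principle for `𝕋_O`: it suffices to treat `0`, elementary tensors `a ⊗ T`, and
sums. [folklore] -/
@[elab_as_elim] theorem induction_on {motive : FullHeckeAlgebra N k O → Prop}
    (x : FullHeckeAlgebra N k O) (zero : motive 0)
    (tmul : ∀ (a : O) (T : heckeRing1 N k), motive (tmul O a T))
    (add : ∀ x y, motive x → motive y → motive (x + y)) : motive x :=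
  TensorProduct.induction_on (motive := motive) x zero tmul add

end FullHeckeAlgebra

end HeckeAlgebra

/-! ### Eigen-augmentations and the congruence ideal of an eigensystem -/

section Eigensystem

variable {N : ℕ} [NeZero N] {k : ℤ} {O : Type*} [CommRing O] (θ : heckeRing1 N k →+* O)

/-- **The eigen-augmentation `π_θ : 𝕋_O →ₐ[O] O`, `a ⊗ T ↦ a · θ(T)`**, of an `O`-valued Hecke
eigensystem `θ : 𝕋_ℤ →+* O` (a ring homomorphism; e.g. `θ = ι ∘ θ_f` for a newform `f` with
coefficients mapped into `O` by `ι : 𝓞_f → O`, Darmon–Diamond–Taylor §4.1, p. 108, and Remark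
3.33: `O`-algebra homomorphisms `𝕋 → O` ↔ newforms with coefficients in `O`). It is the
`O`-linear extension of `θ`, Mathlib's `Algebra.TensorProduct.lift` of `id_O` and `θ`.
[cite: DarmonDiamondTaylor1995, §3.3 Remark 3.33 and §4.1 p. 108] -/
def eigenAugmentation : FullHeckeAlgebra N k O →ₐ[O] O :=
  Algebra.TensorProduct.lift (AlgHom.id O O) θ.toIntAlgHom fun _ _ => Commute.all _ _

/-- `π_θ (a ⊗ T) = a θ(T)`. [folklore] -/
@[simp] theorem eigenAugmentation_tmul (a : O) (T : heckeRing1 N k) :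
    eigenAugmentation θ (FullHeckeAlgebra.tmul O a T) = a * θ T :=
  Algebra.TensorProduct.lift_tmul _ _ _ a T

/-- `π_θ (1 ⊗ T) = θ(T)`: the augmentation extends the eigensystem. [folklore] -/
@[simp] theorem eigenAugmentation_ofInt (T : heckeRing1 N k) :
    eigenAugmentation θ (FullHeckeAlgebra.ofInt O T) = θ T := by
  rw [FullHeckeAlgebra.ofInt_apply, eigenAugmentation_tmul, one_mul]

/-- `π_θ (T_p) = θ(T_p)`, the `T_p`-eigenvalue. [folklore] -/
theorem eigenAugmentation_T (p : ℕ) (hp : p.Prime) :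
    eigenAugmentation θ (FullHeckeAlgebra.T O p hp) =
      θ ⟨(haveI : NeZero p := ⟨hp.ne_zero⟩; heckeT (Gamma1 N) k p),
        (haveI : NeZero p := ⟨hp.ne_zero⟩; heckeT_mem_heckeRing1 p hp)⟩ := by
  rw [FullHeckeAlgebra.T, eigenAugmentation_ofInt]

/-- `π_θ (⟨d⟩) = θ(⟨d⟩)`, the `⟨d⟩`-eigenvalue. [folklore] -/
theorem eigenAugmentation_diamond (d : (ZMod N)ˣ) :
    eigenAugmentation θ (FullHeckeAlgebra.diamond O d) =
      θ ⟨diamondOp N k (d : ZMod N), diamondOp_mem_heckeRing1 d⟩ := by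
  rw [FullHeckeAlgebra.diamond, eigenAugmentation_ofInt]

/-- The kernel of the eigen-augmentation contains `1 ⊗ T − θ(T) ⊗ 1` for every `T ∈ 𝕋_ℤ`
(these elements generate it as an ideal, cf. `FullHeckeAlgebra.induction_on`). [folklore] -/
theorem ofInt_sub_algebraMap_mem_ker (T : heckeRing1 N k) :
    FullHeckeAlgebra.ofInt O T - algebraMap O (FullHeckeAlgebra N k O) (θ T) ∈
      RingHom.ker (eigenAugmentation θ) := by
  rw [RingHom.mem_ker, map_sub, eigenAugmentation_ofInt, AlgHom.commutes, Algebra.algebraMap_self,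
    RingHom.id_apply, sub_self]

/-- Every `x ∈ 𝕋_O` is congruent to the scalar `π_θ(x)` modulo the ideal generated by the
`1 ⊗ T − θ(T) ⊗ 1`. [folklore] -/
theorem sub_algebraMap_mem_span (x : FullHeckeAlgebra N k O) :
    x - algebraMap O (FullHeckeAlgebra N k O) (eigenAugmentation θ x) ∈
      Ideal.span (Set.range fun T : heckeRing1 N k =>
        FullHeckeAlgebra.ofInt O T - algebraMap O (FullHeckeAlgebra N k O) (θ T)) := by
  induction x using FullHeckeAlgebra.induction_on with
  | zero => simp
  | tmul a T =>
    have h : FullHeckeAlgebra.tmul O a T -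
        algebraMap O (FullHeckeAlgebra N k O) (eigenAugmentation θ (FullHeckeAlgebra.tmul O a T)) =
        algebraMap O (FullHeckeAlgebra N k O) a *
          (FullHeckeAlgebra.ofInt O T - algebraMap O (FullHeckeAlgebra N k O) (θ T)) := by
      rw [FullHeckeAlgebra.tmul_eq_smul_ofInt, map_smul, eigenAugmentation_ofInt, Algebra.smul_def,
        smul_eq_mul, map_mul, mul_sub]
    rw [h]
    exact Ideal.mul_mem_left _ _ (Ideal.subset_span ⟨T, rfl⟩)
  | add x y hx hy =>
    rw [map_add, map_add, add_sub_add_comm]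
    exact add_mem hx hy

/-- **The augmentation ideal `I_θ = ker π_θ` is generated by the `1 ⊗ T − θ(T) ⊗ 1`, `T ∈ 𝕋_ℤ`**
(it suffices to let `T` run over the generators `T_p`, `⟨d⟩`; Diamond–Ribet §4.3: congruences
between eigenforms are congruences `a_p(f) ≡ a_p(g)` of eigenvalues). [folklore] -/
theorem ker_eigenAugmentation_eq_span :
    RingHom.ker (eigenAugmentation θ) =
      Ideal.span (Set.range fun T : heckeRing1 N k =>
        FullHeckeAlgebra.ofInt O T - algebraMap O (FullHeckeAlgebra N k O) (θ T)) := by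
  refine le_antisymm (fun x hx => ?_) (Ideal.span_le.mpr ?_)
  · have h := sub_algebraMap_mem_span θ x
    rwa [RingHom.mem_ker.mp hx, map_zero, sub_zero] at h
  · rintro _ ⟨T, rfl⟩
    exact ofInt_sub_algebraMap_mem_ker θ T

/-- **`Ann_{𝕋_O}(ker π_θ)` is the `θ`-eigenspace of `𝕋_ℤ` acting on `𝕋_O`:** `t` annihilates
`ker π_θ` iff `(1 ⊗ T) t = θ(T) t` for all `T ∈ 𝕋_ℤ`. Hence `η_θ = π_θ(𝕋_O[I_θ])`
(cf. Diamond–Ribet §4.3, `η_Σ = ⟨x, y⟩` for a basis of `M_Σ[𝔭_Σ]`). [folklore] -/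
theorem mem_annihilator_ker_eigenAugmentation_iff {t : FullHeckeAlgebra N k O} :
    t ∈ (RingHom.ker (eigenAugmentation θ)).annihilator ↔
      ∀ T : heckeRing1 N k, FullHeckeAlgebra.ofInt O T * t = θ T • t := by
  rw [ker_eigenAugmentation_eq_span, Submodule.mem_annihilator_span]
  constructor
  · intro h T
    have hT := h ⟨_, T, rfl⟩
    rw [smul_eq_mul, mul_sub, sub_eq_zero, mul_comm, mul_comm t] at hT
    rw [hT, Algebra.smul_def]
  · rintro h ⟨_, T, rfl⟩
    rw [smul_eq_mul, mul_sub, sub_eq_zero, mul_comm, h T, Algebra.smul_def, mul_comm]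

/-- The eigen-augmentation is surjective. [folklore] -/
theorem eigenAugmentation_surjective : Function.Surjective (eigenAugmentation θ) :=
  augmentation_surjective (T := FullHeckeAlgebra N k O) (eigenAugmentation θ)

/-- **The congruence ideal `η_θ ⊆ O` of the Hecke eigensystem `θ`**: the congruence ideal
`π(Ann_{𝕋_O}(ker π))` (de Smit–Rubin–Schoof) of the eigen-augmentation `π = π_θ : 𝕋_O → O`.
This is Darmon–Diamond–Taylor's `η = π(Ann_𝕋(ker π))` ((3.3.1), there on the local factor
`𝕋_Σ ≅ 𝕋_𝔪` — the same ideal, `heckeCongruenceIdeal_eq_localized` in the companion file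
`HeckeCongruenceIdealLocal`), Diamond–Ribet's `η_Σ`
(p. 364, measuring "congruences between `f` and other forms of level `N_Σ`", §4.3), and the
ideal `η` with Hida's congruence module `C₀(θ; O) ≅ O/η` (Hida 2000, §5.3.3).
[cite: DarmonDiamondTaylor1995, (3.3.1), p. 97] -/
def heckeCongruenceIdeal : Ideal O :=
  congruenceIdeal (T := FullHeckeAlgebra N k O) (eigenAugmentation θ)

/-- Unfolding lemma for `heckeCongruenceIdeal`. [folklore] -/
theorem heckeCongruenceIdeal_def :
    heckeCongruenceIdeal θ = congruenceIdeal (T := FullHeckeAlgebra N k O) (eigenAugmentation θ) :=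
  rfl

/-- `x ∈ η_θ` iff `x = π_θ(t)` for some `t ∈ 𝕋_O` annihilating `ker π_θ` (Diamond–Ribet §4.3:
"`η_Σ` consists of those `x` such that `(x, 0, …, 0) ∈ 𝕋_Σ`" when `𝕋_Σ ⊗ K ≅ ∏ K`). [folklore] -/
theorem mem_heckeCongruenceIdeal_iff {x : O} :
    x ∈ heckeCongruenceIdeal θ ↔
      ∃ t ∈ (RingHom.ker (eigenAugmentation θ)).annihilator, eigenAugmentation θ t = x :=
  mem_congruenceIdeal_iff (T := FullHeckeAlgebra N k O) (eigenAugmentation θ)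

/-- **Hida's congruence module `C₀(θ; O) = O ⧸ η_θ`** of the eigensystem `θ` (Hida 2000,
§5.3.3, p. 276), a commutative `O`-algebra. [cite: Hida2000, §5.3.3, p. 276] -/
abbrev HeckeCongruenceModule : Type _ :=
  CongruenceModule (T := FullHeckeAlgebra N k O) (eigenAugmentation θ)

end Eigensystem

/-! ### The congruence ideal of a newform -/

section Newform

variable {N : ℕ} [NeZero N] {k : ℤ} {f : CuspForm (Gamma1 N) k}
  {O : Type*} [CommRing O]

/-- **The `O`-valued eigensystem `θ_{f,ι} = ι ∘ θ_f : 𝕋_ℤ →+* O` of a newform `f`** along a ring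
map `ι : 𝓞_f → O` out of the ring of integers of its coefficient field (e.g. into the completion
at a prime `λ`): `T_p ↦ ι(a_p(f))`, `⟨d⟩ ↦ ι(ε_f(d))` (Darmon–Diamond–Taylor §4.1, p. 108, with
the embeddings `K_f ⊆ Q̄ ↪ Q̄_ℓ` fixed there). [cite: DarmonDiamondTaylor1995, §4.1, p. 108] -/
def newformEigensystem [Module.Finite ℤ (heckeRing1 N k)] (hf : IsNewform1 f)
    (ι : coeffCharIntegers f →+* O) : heckeRing1 N k →+* O :=
  ι.comp hf.eigencharacterInt

/-- **The congruence ideal `η_f = η_{f,ι} ⊆ O` of a newform `f ∈ S_k(Γ₁(N))` at `ι : 𝓞_f → O`**: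
the congruence ideal of the eigen-augmentation `π_f : 𝕋_O → O`, `T ↦` eigenvalue of `T` on `f`
(Darmon–Diamond–Taylor (3.3.1); Diamond–Ribet p. 364 and §4.3: for two congruent forms `f, g`
"`η` is the ideal generated by `a_p(f) − a_p(g)`"; Hida 2000, §5.3.3: `C₀(λ; O) ≅ O/η`, with
`|O/η|` the special value `L(1, Ad f)` up to periods and units, Thm. 5.20 — not used here).
For `O = 𝓞_{f,λ}` local this is the congruence ideal of `f` at `λ`; by
`heckeCongruenceIdeal_eq_localized` (companion file) it may equivalently be computed on `𝕋_𝔪`.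
[cite: DarmonDiamondTaylor1995, (3.3.1), p. 97] -/
def newformCongruenceIdeal [Module.Finite ℤ (heckeRing1 N k)] (hf : IsNewform1 f)
    (ι : coeffCharIntegers f →+* O) : Ideal O :=
  heckeCongruenceIdeal (newformEigensystem hf ι)

/-- Unfolding lemma for `newformCongruenceIdeal`. [folklore] -/
theorem newformCongruenceIdeal_def [Module.Finite ℤ (heckeRing1 N k)] (hf : IsNewform1 f)
    (ι : coeffCharIntegers f →+* O) :
    newformCongruenceIdeal hf ι =
      congruenceIdeal (T := FullHeckeAlgebra N k O)
        (eigenAugmentation (ι.comp hf.eigencharacterInt)) :=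
  rfl

/-- The eigen-augmentation of a newform sends `T_p` to `ι(a_p(f))`. [folklore] -/
theorem eigenAugmentation_newformEigensystem_T [Module.Finite ℤ (heckeRing1 N k)]
    (hf : IsNewform1 f) (ι : coeffCharIntegers f →+* O) (p : ℕ) (hp : p.Prime) [NeZero p] :
    eigenAugmentation (newformEigensystem hf ι) (FullHeckeAlgebra.T O p hp) =
      ι (hf.eigencharacterInt ⟨heckeT (Gamma1 N) k p, heckeT_mem_heckeRing1 p hp⟩) := by
  rw [eigenAugmentation_T]
  rfl

/-- … and its value in `ℂ` is `a_p(f)`. [folklore] -/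
theorem coe_eigencharacterInt_heckeT [Module.Finite ℤ (heckeRing1 N k)] (hf : IsNewform1 f)
    (p : ℕ) (hp : p.Prime) [NeZero p] :
    ((hf.eigencharacterInt ⟨heckeT (Gamma1 N) k p, heckeT_mem_heckeRing1 p hp⟩ :
      coeffCharField f) : ℂ) = cuspCoeff f p := by
  rw [IsNewform1.coe_eigencharacterInt, hf.eigencharacter_heckeT p hp]

end Newform

/-! ### Sanity checks: the expected instances are available -/

section Instances

variable (N : ℕ) [NeZero N] (n : ℕ) (k : ℤ) (O : Type*) [CommRing O]

example : Module.Finite O (FullHeckeAlgebra N (n + 2) O) := inferInstance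
example : Module.Free O (FullHeckeAlgebra N (n + 2) O) := inferInstance
example [IsNoetherianRing O] : IsNoetherianRing (FullHeckeAlgebra N (n + 2) O) := inferInstance

/-! Downstream-usage checks (elaboration without explicit type hints). -/

example (θ : heckeRing1 N k →+* O) (x : O) (hx : x ∈ heckeCongruenceIdeal θ) :
    ∃ t ∈ (RingHom.ker (eigenAugmentation θ)).annihilator, eigenAugmentation θ t = x :=
  (mem_heckeCongruenceIdeal_iff θ).mp hx

example (θ : heckeRing1 N k →+* O) :
    heckeCongruenceIdeal θ = ⊥ ↔
      (RingHom.ker (eigenAugmentation θ)).annihilator ≤ RingHom.ker (eigenAugmentation θ) :=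
  congruenceIdeal_eq_bot_iff (eigenAugmentation θ)

example [Module.Finite ℤ (heckeRing1 N k)] {f : CuspForm (Gamma1 N) k}
    (hf : IsNewform1 f) (ι : coeffCharIntegers f →+* O) (x : O) :
    x ∈ newformCongruenceIdeal hf ι ↔ ∃ t ∈ (RingHom.ker (eigenAugmentation
      (newformEigensystem hf ι))).annihilator, eigenAugmentation (newformEigensystem hf ι) t = x :=
  mem_heckeCongruenceIdeal_iff _

end Instances

end Literature.NumberTheory.Automorphic

end
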